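import Literature.Computability.Complexity.CHIterProd
import HarnessLib

/-!
# The approximation sum `∑_q c_q ⌊2ᵀ/q⌋` and its high-order window inside the counting hierarchy

Eighth toolkit file (theorems only) of the scaled-up `FOM + MAJ` calculus. For coefficients
`c ⟨v, bin q⟩` (a `CH`-graph function, `0` off the relevant primes) and a precision `T v` (a
`CH`-graph function), the long number `A v = ∑_{q < 2^{t|v|}} c⟨v, bin q⟩ · ⌊2^{T v}/q⌋` has a `CH`
bit predicate (`approxSum_testBit_mem_CH`), and its window `⌊A v / 2^{T v}⌋ mod 2^{L}` — by
`CRRRank.crrSum_div_eq_approx_div` the RANK of a number given in Chinese remainder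
representation — is a `CH`-graph function (`rankWindowGraph_mem_CH`). This realises, scaled up
to `CH`, the step "each summand `xᵢhᵢ(1/mᵢ)` can be computed to `n^{O(1)}` bits of accuracy
(Lemma 4.2: the `s`-th bit of `1/p` is the low-order bit of `2ˢ mod p`) … using iterated addition
we can compute polynomially many bits of `∑ xᵢhᵢ/mᵢ = X/M + rank(X)`" of Hesse–Allender–Barrington
(JCSS 65 (2002), Lemmas 4.2–4.3), with the bits of `⌊2ᵀ/q⌋` read off `2^{T-b} mod 2q`
(`testBit_two_pow_div`) and two nested iterated additions (`iterSum_testBit_mem_CH`).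

## References

* W. Hesse, E. Allender, D. A. M. Barrington, JCSS 65 (2002), Lemma 4.2, Lemma 4.3.
* P. Bürgisser, ECCC TR06-113 (2006), Thm. 3.4.
-/

namespace Literature.Computability.Complexity

open _root_.Computability Polynomial PRelSigma TTClosure Brick PPSharpP ThresholdPP Plumb Finset

/-! ### Bits of `⌊2ᵀ/q⌋` -/

/-- `(N / q) mod 2 = (N mod 2q) / q` for `q > 0`. [folklore] -/
theorem div_mod_two_eq (N q : ℕ) (hq : 0 < q) : N / q % 2 = N % (2 * q) / q := by
  have h := Nat.div_add_mod N (2 * q)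
  have hr : N % (2 * q) < 2 * q := Nat.mod_lt _ (by omega)
  set k := N / (2 * q)
  set r := N % (2 * q)
  have hN : N = q * (2 * k) + r := by rw [← h]; ring
  rw [hN, Nat.mul_add_div hq, Nat.add_mod, Nat.mul_mod_right, zero_add, Nat.mod_mod,
    Nat.mod_eq_of_lt ((Nat.div_lt_iff_lt_mul hq).2 (by omega))]

/-- **Bits of `⌊2ᵀ/q⌋`** (the binary expansion of `1/q`, HAB Lemma 4.2): bit `b` of `⌊2ᵀ/q⌋` is
set iff `1 ≤ q`, `b ≤ T` and `q ≤ 2^{T-b} mod 2q` ("the `s`-th bit of the binary expansion of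
`1/p` … can be computed from `2ˢ mod p`"). [cite: HesseAllenderBarrington2002, Lemma 4.2] -/
theorem testBit_two_pow_div (T q b : ℕ) :
    (2 ^ T / q).testBit b = decide (1 ≤ q ∧ b ≤ T ∧ q ≤ 2 ^ (T - b) % (2 * q)) := by
  rcases Nat.eq_zero_or_pos q with rfl | hq
  · simp
  by_cases hb : b ≤ T
  · rw [Nat.testBit_eq_decide_div_mod_eq, Nat.div_div_eq_div_mul, mul_comm q, ← Nat.div_div_eq_div_mul,
      Nat.pow_div hb (by norm_num), div_mod_two_eq _ _ hq]
    have hr : 2 ^ (T - b) % (2 * q) < 2 * q := Nat.mod_lt _ (by omega)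
    by_cases hle : q ≤ 2 ^ (T - b) % (2 * q)
    · rw [decide_eq_true (show 2 ^ (T - b) % (2 * q) / q = 1 by rw [Nat.div_eq_iff hq]; omega),
        decide_eq_true ⟨hq, hb, hle⟩]
    · rw [decide_eq_false (show ¬ 2 ^ (T - b) % (2 * q) / q = 1 by rw [Nat.div_eq_of_lt (by omega)]; omega),
        decide_eq_false (fun h => hle h.2.2)]
  · rw [Nat.testBit_lt_two_pow ((Nat.div_le_self _ _).trans_lt (Nat.pow_lt_pow_right (by norm_num) (by omega))),
      decide_eq_false (fun h => hb h.2.1)]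

/-- `∑_{i<N} [bit_i c] · 2ⁱ L = c · L` for `c < 2ᴺ` (multiplication by a binary expansion). [folklore] -/
theorem sum_ite_testBit_mul (c L N : ℕ) (hc : c < 2 ^ N) :
    (∑ i ∈ range N, if c.testBit i = true then 2 ^ i * L else 0) = c * L := by
  conv_rhs => rw [eq_sum_two_pow_mul_testBit hc, Finset.sum_mul]
  refine Finset.sum_congr rfl fun i _ => ?_
  cases c.testBit i <;> simp

/-! ### The bits of the approximation sum -/

section Approx

variable {c T : List Bool → ℕ} {qc qT : Polynomial ℕ}

/-- The shifted-window summand on `y = ⟨x', bin i⟩`, `x' = ⟨v, q⟩`: `2ⁱ · ⌊2^{T v}/val q⌋` if bit `i`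
of `c x'` is set, else `0`; its bit predicate is in `CH` (bit of `c`, and the bit formula
`testBit_two_pow_div` with `T v` substituted into the modular-exponentiation atom). [cite: HesseAllenderBarrington2002, Lemma 4.2] -/
theorem shiftSummand_testBit_mem_CH (hc : {z | c (fstP z) = bitsToNat (sndP z)} ∈ CH) (hcb : ∀ w, c w < 2 ^ qc.eval w.length)
    (hT : {z | T (fstP z) = bitsToNat (sndP z)} ∈ CH) (hTb : ∀ w, T w < 2 ^ qT.eval w.length) :
    {z | ((if (c (fstP (fstP z))).testBit (bitsToNat (sndP (fstP z))) = true then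
        2 ^ bitsToNat (sndP (fstP z)) * (2 ^ T (fstP (fstP (fstP z))) / bitsToNat (sndP (fstP (fstP z)))) else 0)).testBit
        (bitsToNat (sndP z)) = true} ∈ CH := by
  -- `Bc`: bit `i` of `c x'` (`⟨x', bin i⟩ = fstP z`)
  have hBc : fstP ⁻¹' {y | (c (fstP y)).testBit (bitsToNat (sndP y)) = true} ∈ CH :=
    preimage_mem_CH (testBitGraph_mem_CH hc hcb) fstP_mem_FP
  -- `i ≤ j`, `1 ≤ q`
  have hLij : (pairFn (sndP ∘ fstP) sndP ⁻¹' ({u | bitsToNat (fstP u) ≤ bitsToNat (sndP u)} : Language Bool)) ∈ Classes.P :=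
    preimage_mem_P leVal_mem_P (pairFn_mem_FP (comp_mem_FP sndP_mem_FP fstP_mem_FP) sndP_mem_FP)
  have hQ1 : ((sndP ∘ fstP ∘ fstP) ⁻¹' ({w | 1 ≤ bitsToNat w} : Language Bool)) ∈ Classes.P :=
    preimage_mem_P (constLeVal_mem_P 1) (comp_mem_FP sndP_mem_FP (comp_mem_FP fstP_mem_FP fstP_mem_FP))
  -- `D`: `j - i ≤ T v`
  have hD := preimage_mem_CH (geGraph_mem_CH hT hTb)
    (pairFn_mem_FP (comp_mem_FP fstP_mem_FP (comp_mem_FP fstP_mem_FP fstP_mem_FP))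
      (comp_mem_FP subFn_mem_FP (pairFn_mem_FP sndP_mem_FP (comp_mem_FP sndP_mem_FP fstP_mem_FP))))
  -- the exponent `ex z = T v - (j - i)`
  obtain ⟨s₁, hs₁⟩ := exists_poly_length_le_of_mem_FP (comp_mem_FP fstP_mem_FP (comp_mem_FP fstP_mem_FP fstP_mem_FP))
  obtain ⟨s₂, hs₂⟩ := exists_val_lt_of_mem_FP (comp_mem_FP subFn_mem_FP (pairFn_mem_FP sndP_mem_FP (comp_mem_FP sndP_mem_FP fstP_mem_FP)))
  have hex := comp₂_graph_mem_CH (op := fun a b => a - b) (P_subset_CH subGraph_mem_P)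
    (f₁ := fun z => T ((fstP ∘ fstP ∘ fstP) z)) (graph_comp_FP_mem_CH hT (comp_mem_FP fstP_mem_FP (comp_mem_FP fstP_mem_FP fstP_mem_FP)))
    (bound_comp_FP hTb hs₁)
    (f₂ := fun z => bitsToNat ((subFn ∘ pairFn sndP (sndP ∘ fstP)) z))
    (graphFP_mem_CH (comp_mem_FP subFn_mem_FP (pairFn_mem_FP sndP_mem_FP (comp_mem_FP sndP_mem_FP fstP_mem_FP)))) hs₂
  have hexb : ∀ z, T ((fstP ∘ fstP ∘ fstP) z) - bitsToNat ((subFn ∘ pairFn sndP (sndP ∘ fstP)) z) < 2 ^ (qT.comp s₁).eval z.length :=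
    fun z => (Nat.sub_le _ _).trans_lt (bound_comp_FP hTb hs₁ z)
  -- `R = {⟨bin e', z⟩ | val q ≤ val (modExpFn ⟨bin 2, ⟨bin e', bin 2q⟩⟩)}`
  have hF : pairFn (fun _ => encodeNat 2) (pairFn fstP (prodFn ∘ pairFn (fun _ => encodeNat 2) (sndP ∘ fstP ∘ fstP ∘ sndP))) ∈ FP :=
    pairFn_mem_FP (const_mem_FP _) (pairFn_mem_FP fstP_mem_FP (comp_mem_FP prodFn_mem_FP
      (pairFn_mem_FP (const_mem_FP _) (comp_mem_FP sndP_mem_FP (comp_mem_FP fstP_mem_FP (comp_mem_FP fstP_mem_FP sndP_mem_FP))))))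
  have hR : (pairFn (sndP ∘ fstP ∘ fstP ∘ sndP) (modExpFn ∘ pairFn (fun _ => encodeNat 2)
      (pairFn fstP (prodFn ∘ pairFn (fun _ => encodeNat 2) (sndP ∘ fstP ∘ fstP ∘ sndP)))) ⁻¹'
      ({u | bitsToNat (fstP u) ≤ bitsToNat (sndP u)} : Language Bool)) ∈ Classes.P :=
    preimage_mem_P leVal_mem_P (pairFn_mem_FP (comp_mem_FP sndP_mem_FP (comp_mem_FP fstP_mem_FP (comp_mem_FP fstP_mem_FP sndP_mem_FP)))
      (comp_mem_FP modExpFn_mem_FP hF))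
  have hE := rel_apply_mem_CH (P_subset_CH hR)
    (f := fun z => T ((fstP ∘ fstP ∘ fstP) z) - bitsToNat ((subFn ∘ pairFn sndP (sndP ∘ fstP)) z)) hex hexb OracleCompose.id_mem_FP
  refine mem_CH_of_iff (inter_mem_CH hBc (inter_P_mem_CH hLij (inter_P_mem_CH hQ1 (inter_mem_CH hD hE)))) _ fun z => ?_
  rw [memL_inf', memL_inf', memL_inf', memL_inf']
  change ((if (c (fstP (fstP z))).testBit (bitsToNat (sndP (fstP z))) = true then
        2 ^ bitsToNat (sndP (fstP z)) * (2 ^ T (fstP (fstP (fstP z))) / bitsToNat (sndP (fstP (fstP z)))) else 0).testBit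
        (bitsToNat (sndP z)) = true) ↔ (c (fstP (fstP z))).testBit (bitsToNat (sndP (fstP z))) = true ∧
    bitsToNat (fstP (pairFn (sndP ∘ fstP) sndP z)) ≤ bitsToNat (sndP (pairFn (sndP ∘ fstP) sndP z)) ∧
    1 ≤ bitsToNat ((sndP ∘ fstP ∘ fstP) z) ∧
    bitsToNat (sndP (pairFn (fstP ∘ fstP ∘ fstP) (subFn ∘ pairFn sndP (sndP ∘ fstP)) z)) ≤
        T (fstP (pairFn (fstP ∘ fstP ∘ fstP) (subFn ∘ pairFn sndP (sndP ∘ fstP)) z)) ∧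
    bitsToNat (fstP (pairFn (sndP ∘ fstP ∘ fstP ∘ sndP) (modExpFn ∘ pairFn (fun _ => encodeNat 2)
        (pairFn fstP (prodFn ∘ pairFn (fun _ => encodeNat 2) (sndP ∘ fstP ∘ fstP ∘ sndP))))
        (boolPair (encodeNat (T ((fstP ∘ fstP ∘ fstP) (id z)) - bitsToNat ((subFn ∘ pairFn sndP (sndP ∘ fstP)) (id z)))) (id z)))) ≤
      bitsToNat (sndP (pairFn (sndP ∘ fstP ∘ fstP ∘ sndP) (modExpFn ∘ pairFn (fun _ => encodeNat 2)
        (pairFn fstP (prodFn ∘ pairFn (fun _ => encodeNat 2) (sndP ∘ fstP ∘ fstP ∘ sndP))))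
        (boolPair (encodeNat (T ((fstP ∘ fstP ∘ fstP) (id z)) - bitsToNat ((subFn ∘ pairFn sndP (sndP ∘ fstP)) (id z)))) (id z))))
  simp only [pairFn_apply, Function.comp_apply, fstP_boolPair, sndP_boolPair, subFn_boolPair, prodFn_boolPair, bitsToNat_encodeNat, id,
    bitsToNat_modExpFn]
  -- abbreviations
  set v := fstP (fstP (fstP z))
  set q := bitsToNat (sndP (fstP (fstP z)))
  set i := bitsToNat (sndP (fstP z))
  set j := bitsToNat (sndP z)
  by_cases hbit : (c (fstP (fstP z))).testBit i = true
  · rw [if_pos hbit, Nat.testBit_two_pow_mul, testBit_two_pow_div, Bool.and_eq_true, decide_eq_true_iff, decide_eq_true_iff]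
    simp only [hbit, true_and, ge_iff_le]
    refine and_congr Iff.rfl (and_congr Iff.rfl (and_congr Iff.rfl ?_))
    by_cases hq : 2 * q ≤ 1
    · rw [if_pos hq]
      have hq0 : q = 0 := by omega
      rw [hq0]; simp
    · rw [if_neg hq]
  · rw [if_neg hbit]
    simp only [Nat.zero_testBit, Bool.false_eq_true, false_iff, not_and]
    exact fun h => absurd h hbit

/-- **The bits of `c x' · ⌊2^{T v}/q⌋` are in `CH`** (`x' = ⟨v, q⟩`): inner iterated addition of the
shifted copies `2ⁱ ⌊2^{T v}/q⌋` over the bits `i` of `c x'`. [cite: HesseAllenderBarrington2002, Lemma 4.3] -/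
theorem coeffMulDiv_testBit_mem_CH (hc : {z | c (fstP z) = bitsToNat (sndP z)} ∈ CH) (hcb : ∀ w, c w < 2 ^ qc.eval w.length)
    (hT : {z | T (fstP z) = bitsToNat (sndP z)} ∈ CH) (hTb : ∀ w, T w < 2 ^ qT.eval w.length) :
    {z | (c (fstP z) * (2 ^ T (fstP (fstP z)) / bitsToNat (sndP (fstP z)))).testBit (bitsToNat (sndP z)) = true} ∈ CH := by
  refine mem_CH_of_iff (iterSum_testBit_mem_CH qc
    (G := fun y => if (c (fstP y)).testBit (bitsToNat (sndP y)) = true then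
      2 ^ bitsToNat (sndP y) * (2 ^ T (fstP (fstP y)) / bitsToNat (sndP (fstP y))) else 0)
    (shiftSummand_testBit_mem_CH hc hcb hT hTb)) _ fun z => ?_
  change _ ↔ (∑ i ∈ range (2 ^ qc.eval (fstP z).length),
    (if (c (fstP (boolPair (fstP z) (encodeNat i)))).testBit (bitsToNat (sndP (boolPair (fstP z) (encodeNat i)))) = true then
      2 ^ bitsToNat (sndP (boolPair (fstP z) (encodeNat i))) *
        (2 ^ T (fstP (fstP (boolPair (fstP z) (encodeNat i)))) / bitsToNat (sndP (fstP (boolPair (fstP z) (encodeNat i)))))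
      else 0)).testBit (bitsToNat (sndP z)) = true
  simp only [fstP_boolPair, sndP_boolPair, bitsToNat_encodeNat]
  rw [sum_ite_testBit_mul _ _ _ ((hcb _).trans_le (Nat.pow_le_pow_right (by norm_num) Nat.lt_two_pow_self.le))]
  exact Iff.rfl

/-- **The approximation sum has a `CH` bit predicate**: for `A v = ∑_{q < 2^{t|v|}} c⟨v, bin q⟩ ⌊2^{T v}/q⌋`,
`{⟨v, j⟩ | bit (val j) of A v} ∈ CH` — outer iterated addition over `q` (HAB 2002, proof of
Lemma 4.3, scaled: "since iterated addition is in FOM, we can thus compute polynomially-many bits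
of the binary representation of `∑ xᵢhᵢ(1/mᵢ)`"). [cite: HesseAllenderBarrington2002, Lemma 4.3] -/
theorem approxSum_testBit_mem_CH (hc : {z | c (fstP z) = bitsToNat (sndP z)} ∈ CH) (hcb : ∀ w, c w < 2 ^ qc.eval w.length)
    (hT : {z | T (fstP z) = bitsToNat (sndP z)} ∈ CH) (hTb : ∀ w, T w < 2 ^ qT.eval w.length) (tq : Polynomial ℕ) :
    {z | (∑ q ∈ range (2 ^ tq.eval (fstP z).length), c (boolPair (fstP z) (encodeNat q)) * (2 ^ T (fstP z) / q)).testBit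
      (bitsToNat (sndP z)) = true} ∈ CH := by
  refine mem_CH_of_iff (iterSum_testBit_mem_CH tq
    (G := fun y => c y * (2 ^ T (fstP y) / bitsToNat (sndP y))) (coeffMulDiv_testBit_mem_CH hc hcb hT hTb)) _ fun z => ?_
  change _ ↔ (∑ i ∈ range (2 ^ tq.eval (fstP z).length),
    c (boolPair (fstP z) (encodeNat i)) * (2 ^ T (fstP (boolPair (fstP z) (encodeNat i))) /
      bitsToNat (sndP (boolPair (fstP z) (encodeNat i))))).testBit (bitsToNat (sndP z)) = true
  simp only [fstP_boolPair, sndP_boolPair, bitsToNat_encodeNat]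
  exact Iff.rfl

/-! ### The rank window -/

/-- **The high-order window of the approximation sum is a `CH`-graph function**:
`v ↦ ⌊A v / 2^{T v}⌋ mod 2^{L(|v|)}` (the window of `A v` at position `T v`, `windowGraph_mem_CH`, with
`T v` substituted) — by `crrSum_div_eq_approx_div` this is the rank of a number given by its
residues, whenever the rank is below `2^{L(|v|)}`. [cite: HesseAllenderBarrington2002, Lemma 4.3] -/
theorem rankWindowGraph_mem_CH (hc : {z | c (fstP z) = bitsToNat (sndP z)} ∈ CH) (hcb : ∀ w, c w < 2 ^ qc.eval w.length)
    (hT : {z | T (fstP z) = bitsToNat (sndP z)} ∈ CH) (hTb : ∀ w, T w < 2 ^ qT.eval w.length) (tq L0 : Polynomial ℕ) :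
    {z | (∑ q ∈ range (2 ^ tq.eval (fstP z).length), c (boolPair (fstP z) (encodeNat q)) * (2 ^ T (fstP z) / q)) /
        2 ^ T (fstP z) % 2 ^ L0.eval (fstP z).length = bitsToNat (sndP z)} ∈ CH := by
  have hW := windowGraph_mem_CH
    (G := fun v => ∑ q ∈ range (2 ^ tq.eval v.length), c (boolPair v (encodeNat q)) * (2 ^ T v / q))
    (approxSum_testBit_mem_CH hc hcb hT hTb tq)
  -- `R = {⟨bin τ, ⟨v, ν⟩⟩ | window of A v at τ of length L0|v| = val ν}`
  have hF : pairFn (pairFn (fstP ∘ sndP) (pairFn fstP (polyFn L0 ∘ fstP ∘ sndP))) (sndP ∘ sndP) ∈ FP :=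
    pairFn_mem_FP (pairFn_mem_FP (comp_mem_FP fstP_mem_FP sndP_mem_FP) (pairFn_mem_FP fstP_mem_FP
      (comp_mem_FP (polyFn_mem_FP L0) (comp_mem_FP fstP_mem_FP sndP_mem_FP)))) (comp_mem_FP sndP_mem_FP sndP_mem_FP)
  have hR := preimage_mem_CH hW hF
  refine mem_CH_of_iff (rel_apply_mem_CH hR (f := T) hT hTb fstP_mem_FP) _ fun z => ?_
  have key : ∀ (F : List Bool → List Bool) (r : List Bool),
      r ∈ F ⁻¹' {z | (∑ q ∈ range (2 ^ tq.eval (fstP (fstP z)).length),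
          c (boolPair (fstP (fstP z)) (encodeNat q)) * (2 ^ T (fstP (fstP z)) / q)) /
        2 ^ bitsToNat (fstP (sndP (fstP z))) % 2 ^ (sndP (sndP (fstP z))).length = bitsToNat (sndP z)} ↔
      (fun z => (∑ q ∈ range (2 ^ tq.eval (fstP (fstP z)).length),
          c (boolPair (fstP (fstP z)) (encodeNat q)) * (2 ^ T (fstP (fstP z)) / q)) /
        2 ^ bitsToNat (fstP (sndP (fstP z))) % 2 ^ (sndP (sndP (fstP z))).length = bitsToNat (sndP z)) (F r) := fun F r => Iff.rfl
  refine Iff.trans ?_ (key (fun x => (pairFn (pairFn (fstP ∘ sndP) (pairFn fstP (polyFn L0 ∘ fstP ∘ sndP))) (sndP ∘ sndP))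
    (boolPair (encodeNat (T (fstP x))) x)) z).symm
  simp only [pairFn_apply, Function.comp_apply, fstP_boolPair, sndP_boolPair, bitsToNat_encodeNat, polyFn_apply, List.length_replicate]
  exact Iff.rfl

/-- The rank window is below `2^{L(|v|)} ≤ 2^{L(|w|)}`. [folklore] -/
theorem rankWindow_lt_two_pow (c T : List Bool → ℕ) (tq L0 : Polynomial ℕ) (w : List Bool) :
    (∑ q ∈ range (2 ^ tq.eval (fstP w).length), c (boolPair (fstP w) (encodeNat q)) * (2 ^ T (fstP w) / q)) /
        2 ^ T (fstP w) % 2 ^ L0.eval (fstP w).length < 2 ^ L0.eval w.length :=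
  (Nat.mod_lt _ (Nat.two_pow_pos _)).trans_le (Nat.pow_le_pow_right (by norm_num) (TM2Iter.eval_mono L0 (length_fstP_le w)))

end Approx

end Literature.Computability.Complexity
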